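import Summits.AtomisticToContinuum.BoseEinsteinCondensation.Theorems.GroundStateStability.Negative.WindowTightness

/-!
# Crux `GroundStateStability` (stmt-AtomisticToContinuum-9672) — the Born weights `|Ψ₀|²` are NOT strongly Rayleigh

Crux-disprover result (route BECStronglyRayleigh, seat `refuter-cdisprove-stmt-AtomisticToContinuum-9672-0`):
`groundStateStability_false_squared : ¬ GroundStateStabilitySquared` — the crux with its conclusion
strengthened from the amplitudes `ψ(1_S)` to their squares (for the Perron ground vector: the Born weights,
the law of the boson positions) fails INSIDE the window: 4-cycle, `N = 2`, `μ = 0`, `Δ = -1/6`; the sector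
ground vector `ψ₁ = (3` diagonals`, 2` edges`)` (`E_min = -3/2`, sum-of-squares certificate `quadForm_H₁`)
is stable, but `ψ₁² = (9,4)` has pair kernel `circ(0,4,9,4)` with eigenvalues `17, 1, -9, -9`; its polynomial
`9(z₀z₂+z₁z₃) + 4(z₀z₁+z₁z₂+z₂z₃+z₃z₀)` vanishes at `(6+2i, -6+i, 6+i, -6+2i) ∈ H⁴`. By hand: on `C4` the
Born weights are stable iff `Δ ≥ 0`, critical exactly at pure hopping `Δ = 0` — so the card's empirical
"conjecture P" cannot survive any repulsion, and negative dependence of the actual density correlations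
does not follow from the crux. Uses the machinery of `Negative.WindowTightness`. All [folklore].
-/

noncomputable section

namespace Summit.AtomisticToContinuum.BoseEinsteinCondensation.Theorems.GroundStateStability.Negative

open scoped BigOperators Matrix ComplexOrder
open Literature.MathematicalPhysics.QuantumLattice Matrix Complex

/-! ### The squared amplitudes (Born weights) are NOT strongly Rayleigh inside the window -/

/-- The field-free ferromagnetic XXZ Hamiltonian on the 4-cycle at `Δ = -1/6` (inside the window). -/
def H₁ : Op (Fin 4) 2 :=
  xxzHamiltonian 1 C4 (-1) (-1 / 6 : ℝ) +
    ∑ x : Fin 4, (((fun _ : Fin 4 => (0 : ℝ)) x : ℝ) : ℂ) • siteSpin 1 x 2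

/-- Its sector ground vector: `3` on the diagonal pairs, `2` on the edges. -/
def ψ₁ : TensorIndex (Fin 4) 2 → ℂ := fun σ =>
  if (∑ z, (σ z : ℕ)) = 2 then (if σ 0 = σ 2 then 3 else 2) else 0

/-- `H₁ ψ₁ = -(3/2) ψ₁`, configuration by configuration. [folklore] -/
theorem H₁_mulVec_ψ₁_apply (a b c d : Fin 2) :
    (H₁ *ᵥ ψ₁) ![a, b, c, d] = (-(3 / 2) : ℂ) * ψ₁ ![a, b, c, d] := by
  rw [H₁, H_C4_apply]
  fin_cases a <;> fin_cases b <;> fin_cases c <;> fin_cases d <;>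
    simp [ψ₁, qq, hh, Fin.sum_univ_four] <;> norm_num

/-- The eigen-equation `H₁ ψ₁ = -(3/2) ψ₁`. [folklore] -/
theorem H₁_mulVec_ψ₁ : H₁ *ᵥ ψ₁ = (-(3 / 2) : ℂ) • ψ₁ := by
  funext σ
  rw [vec4_eta σ, Pi.smul_apply, smul_eq_mul]
  exact H₁_mulVec_ψ₁_apply _ _ _ _

/-- `ψ₁` lies in the two-particle sector. [folklore] -/
theorem ψ₁_mem : ψ₁ ∈ spinZSector 1 (((Fintype.card (Fin 4) * 1 : ℕ) : ℝ) / 2 - (2 : ℕ)) :=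
  (LiebMattis.mem_spinZSector_weight_iff 1 2 ψ₁).2 fun _ hσ => if_neg hσ

/-- `ψ₁ ≠ 0`. [folklore] -/
theorem ψ₁_ne_zero : ψ₁ ≠ 0 := by
  intro h
  have := congrFun h ![0, 1, 0, 1]
  simp [ψ₁, Fin.sum_univ_four] at this

/-- Sum-of-squares certificate `⟨φ,(H₁+3/2)φ⟩ = (3/2)Σ_i|a_i - s/3|² + (2/3)|d₁-d₂|²`. [folklore] -/
theorem quadForm_H₁ (φ : TensorIndex (Fin 4) 2 → ℂ) (hφ : ∀ σ, (∑ z, (σ z : ℕ)) ≠ 2 → φ σ = 0) :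
    (star φ ⬝ᵥ H₁ *ᵥ φ).re + 3 / 2 * (star φ ⬝ᵥ φ).re =
      3 / 2 * (((φ ![0, 0, 1, 1]).re - ((φ ![0, 1, 0, 1]).re + (φ ![1, 0, 1, 0]).re) / 3) ^ 2 +
            ((φ ![0, 0, 1, 1]).im - ((φ ![0, 1, 0, 1]).im + (φ ![1, 0, 1, 0]).im) / 3) ^ 2 +
          (((φ ![1, 0, 0, 1]).re - ((φ ![0, 1, 0, 1]).re + (φ ![1, 0, 1, 0]).re) / 3) ^ 2 +
            ((φ ![1, 0, 0, 1]).im - ((φ ![0, 1, 0, 1]).im + (φ ![1, 0, 1, 0]).im) / 3) ^ 2) +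
          (((φ ![1, 1, 0, 0]).re - ((φ ![0, 1, 0, 1]).re + (φ ![1, 0, 1, 0]).re) / 3) ^ 2 +
            ((φ ![1, 1, 0, 0]).im - ((φ ![0, 1, 0, 1]).im + (φ ![1, 0, 1, 0]).im) / 3) ^ 2) +
          (((φ ![0, 1, 1, 0]).re - ((φ ![0, 1, 0, 1]).re + (φ ![1, 0, 1, 0]).re) / 3) ^ 2 +
            ((φ ![0, 1, 1, 0]).im - ((φ ![0, 1, 0, 1]).im + (φ ![1, 0, 1, 0]).im) / 3) ^ 2)) +
        (2 / 3) * (((φ ![0, 1, 0, 1]).re - (φ ![1, 0, 1, 0]).re) ^ 2 +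
          ((φ ![0, 1, 0, 1]).im - (φ ![1, 0, 1, 0]).im) ^ 2) := by
  have h1 : ∀ σ, (∑ z, (σ z : ℕ)) ≠ 2 → star (φ σ) * (H₁ *ᵥ φ) σ = 0 := fun σ hσ => by
    rw [hφ σ hσ, star_zero, zero_mul]
  have h2 : ∀ σ, (∑ z, (σ z : ℕ)) ≠ 2 → star (φ σ) * φ σ = 0 := fun σ hσ => by
    rw [hφ σ hσ, star_zero, zero_mul]
  simp only [dotProduct, Pi.star_apply]
  rw [sum_sector _ h1, sum_sector _ h2]
  simp only [H₁, H_C4_apply, qq, hh]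
  simp [Complex.mul_re, Complex.mul_im]
  ring

/-- The sector energy of `H₁` is exactly `-3/2`. [folklore] -/
theorem lowestEnergyInSector_H₁ :
    lowestEnergyInSector 1 H₁ (((Fintype.card (Fin 4) * 1 : ℕ) : ℝ) / 2 - (2 : ℕ)) = -(3 / 2) := by
  unfold lowestEnergyInSector Matrix.minEnergyOn
  set K := spinZSector (Λ := Fin 4) 1 (((Fintype.card (Fin 4) * 1 : ℕ) : ℝ) / 2 - (2 : ℕ)) with hK
  have hlow : ∀ E ∈ {E : ℝ | ∃ ψ ∈ K, star ψ ⬝ᵥ ψ = 1 ∧ E = (star ψ ⬝ᵥ H₁ *ᵥ ψ).re}, -(3 / 2) ≤ E := by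
    rintro E ⟨φ, hφK, hφ1, rfl⟩
    have hφ := (LiebMattis.mem_spinZSector_weight_iff 1 2 φ).1 hφK
    have h := quadForm_H₁ φ hφ
    rw [hφ1, Complex.one_re] at h
    nlinarith [h, sq_nonneg ((φ ![0, 0, 1, 1]).re - ((φ ![0, 1, 0, 1]).re + (φ ![1, 0, 1, 0]).re) / 3),
      sq_nonneg ((φ ![0, 0, 1, 1]).im - ((φ ![0, 1, 0, 1]).im + (φ ![1, 0, 1, 0]).im) / 3),
      sq_nonneg ((φ ![1, 0, 0, 1]).re - ((φ ![0, 1, 0, 1]).re + (φ ![1, 0, 1, 0]).re) / 3),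
      sq_nonneg ((φ ![1, 0, 0, 1]).im - ((φ ![0, 1, 0, 1]).im + (φ ![1, 0, 1, 0]).im) / 3),
      sq_nonneg ((φ ![1, 1, 0, 0]).re - ((φ ![0, 1, 0, 1]).re + (φ ![1, 0, 1, 0]).re) / 3),
      sq_nonneg ((φ ![1, 1, 0, 0]).im - ((φ ![0, 1, 0, 1]).im + (φ ![1, 0, 1, 0]).im) / 3),
      sq_nonneg ((φ ![0, 1, 1, 0]).re - ((φ ![0, 1, 0, 1]).re + (φ ![1, 0, 1, 0]).re) / 3),
      sq_nonneg ((φ ![0, 1, 1, 0]).im - ((φ ![0, 1, 0, 1]).im + (φ ![1, 0, 1, 0]).im) / 3),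
      sq_nonneg ((φ ![0, 1, 0, 1]).re - (φ ![1, 0, 1, 0]).re),
      sq_nonneg ((φ ![0, 1, 0, 1]).im - (φ ![1, 0, 1, 0]).im)]
  have hmem : (-(3 / 2) : ℝ) ∈ {E : ℝ | ∃ ψ ∈ K, star ψ ⬝ᵥ ψ = 1 ∧ E = (star ψ ⬝ᵥ H₁ *ᵥ ψ).re} := by
    obtain ⟨c, -, hc1⟩ := exists_smul_unit ψ₁_ne_zero
    refine ⟨c • ψ₁, K.smul_mem c ψ₁_mem, hc1, ?_⟩
    rw [Matrix.mulVec_smul, H₁_mulVec_ψ₁, smul_comm, dotProduct_smul, hc1]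
    norm_num
  exact le_antisymm (csInf_le ⟨-(3 / 2), hlow⟩ hmem) (le_csInf ⟨-(3 / 2), hmem⟩ hlow)

/-- The SQUARED-amplitude polynomial of `ψ₁`, `9(z₀z₂+z₁z₃) + 4(z₀z₁+z₁z₂+z₂z₃+z₃z₀)`, vanishes at
`(6+2i, -6+i, 6+i, -6+2i) ∈ H⁴`. [folklore] -/
theorem ψ₁_sq_poly_zero :
    (∑ S : Finset (Fin 4), ψ₁ (fun x => if x ∈ S then 0 else 1) ^ 2 *
        ∏ x ∈ S, (![6 + 2 * I, -6 + I, 6 + I, -6 + 2 * I] : Fin 4 → ℂ) x) = 0 := by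
  have hvan : ∀ S : Finset (Fin 4), S ∉ ({{0, 1}, {0, 2}, {0, 3}, {1, 2}, {1, 3}, {2, 3}} : Finset (Finset (Fin 4))) →
      (∑ z, (((fun x => if x ∈ S then (0 : Fin 2) else 1) z : Fin 2) : ℕ)) ≠ 2 := by
    decide
  rw [← Finset.sum_subset (Finset.subset_univ ({{0, 1}, {0, 2}, {0, 3}, {1, 2}, {1, 3}, {2, 3}} : Finset (Finset (Fin 4))))]
  · rw [Finset.sum_insert (by decide), Finset.sum_insert (by decide), Finset.sum_insert (by decide),
      Finset.sum_insert (by decide), Finset.sum_insert (by decide), Finset.sum_singleton,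
      Finset.prod_pair (by decide), Finset.prod_pair (by decide), Finset.prod_pair (by decide),
      Finset.prod_pair (by decide), Finset.prod_pair (by decide), Finset.prod_pair (by decide)]
    simp [ψ₁, Fin.sum_univ_four]
    ring_nf
    simp [Complex.I_sq]
  · intro S _ hS
    rw [ψ₁, if_neg (hvan S hS)]
    simp

/-- The crux with the conclusion strengthened from the amplitudes `ψ(1_S)` to their SQUARES
(for the Perron ground vector: the Born weights `|Ψ₀(S)|²`, the law of the boson positions). -/
def GroundStateStabilitySquared : Prop :=
  ∀ (Λ : Type) [Fintype Λ] [DecidableEq Λ] (G : SimpleGraph Λ) [DecidableRel G.Adj], G.Connected →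
    ∀ (Δ : ℝ) (μ : Λ → ℝ), |Δ| ≤ 1 → ∀ (M : ℝ) (ψ : TensorIndex Λ 2 → ℂ), ψ ∈ spinZSector 1 M → ψ ≠ 0 →
      (xxzHamiltonian 1 G (-1) Δ + ∑ x : Λ, ((μ x : ℝ) : ℂ) • siteSpin 1 x 2).mulVec ψ =
        ((lowestEnergyInSector 1 (xxzHamiltonian 1 G (-1) Δ + ∑ x : Λ, ((μ x : ℝ) : ℂ) • siteSpin 1 x 2) M : ℝ) : ℂ) • ψ →
      ∀ z : Λ → ℂ, (∀ x, 0 < (z x).im) →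
        (∑ S : Finset Λ, ψ (fun x => if x ∈ S then 0 else 1) ^ 2 * ∏ x ∈ S, z x) ≠ 0

/-- **The Born weights `|Ψ₀|²` are not strongly Rayleigh in general, even deep inside the window**
(refutes the natural strengthening "conjecture P" beyond pure hopping): 4-cycle, two particles, no
field, `Δ = -1/6`; the sector ground vector `ψ₁ = (3` on diagonals`, 2` on edges`)` is stable (pair
kernel `circ(0,2,3,2)`, `3 ≤ 2·2`), but `ψ₁²  = (9, 4)` has pair kernel `circ(0,4,9,4)` with eigenvalues
`17, 1, -9, -9` — two positive. By hand: on `C4`, `N = 2`, `μ = 0`, `ψ²` is stable iff `a² ≤ 2b²` iff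
`Δ ≥ 0`, with equality (criticality) exactly at the pure-hopping point `Δ = 0`. [folklore] -/
theorem groundStateStability_false_squared : ¬ GroundStateStabilitySquared := by
  intro h
  have hH : (xxzHamiltonian 1 C4 (-1) (-1 / 6 : ℝ) +
      ∑ x : Fin 4, (((fun _ : Fin 4 => (0 : ℝ)) x : ℝ) : ℂ) • siteSpin 1 x 2) = H₁ := rfl
  refine h (Fin 4) C4 SimpleGraph.cycleGraph_connected (-1 / 6) (fun _ => 0)
    (by rw [abs_le]; constructor <;> norm_num) _ ψ₁ ψ₁_mem ψ₁_ne_zero ?_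
    ![6 + 2 * I, -6 + I, 6 + I, -6 + 2 * I] ?_ ψ₁_sq_poly_zero
  · rw [hH, lowestEnergyInSector_H₁, H₁_mulVec_ψ₁]
    push_cast
    ring_nf
  · intro x
    fin_cases x <;> simp


end Summit.AtomisticToContinuum.BoseEinsteinCondensation.Theorems.GroundStateStability.Negative
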